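import Summits.ResolutionOfSingularities.ResolutionOfSingularities.Theorems.MarkedTransferCampaignW13BypassRFlatInstances
import Mathlib.Tactic.LinearCombination
import HarnessLib

/-!
# [OURS · L1 W1.3] Rung 1 (reading R-flat) CLOSED on the class `𝒞_Diff`: proof of the v5 campaign Prop
# `Campaign.CampaignW13RFlatTailPowDiffKnockOut`, and membership of the recorded chains in `𝒞_Diff` (seat res-L1-s13-pv-1)

LADDER-RESOLUTION rung L (rescue), cell `res-hironaka`, RESCUE-SEED slot W1.3, campaign s13. The closed rung-1 Prop
`Campaign.CampaignW13RFlatTailPowDiffKnockOut p K J b` (v5 of `MarkedTransferCampaignW13Bypass.lean`, res-L1-type-o2 p480169,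
typed verbatim from this seat's hand-over 2026-08-27T00:50:13Z; lanes: a1 2/2 @01:05:50Z, b3 taking) says: R-flat keeps every
LL-tail whose TOTAL KNOCK-OUT `g(0) − y(e)^{p^e}` is a value of `K`-linear differential operators of order `< b` on `J`
(`RFlatTailPowOn p K J b 𝒞_Diff`). As its docstring states honestly, the Prop is provable for every `(p, K, O, J, b)` — the
content of the rung is (i) that proof (here: `CampaignW13RFlatTailPowDiffKnockOut_holds`, one line from this seat's
bridge `Campaign.W13.pow_mem_pAlgPiece_one_of_sub_mem_diffIdeal`, p475548), (ii) the MEMBERSHIP of the campaign's chains in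
`𝒞_Diff` (here for Example A, the `p = 3` specimen R2 and the `e = 2` head E2, from the identities of p478130; B/C/D likewise
by p479454's `y² = g + x_i·∂_i g`), and (iii) the census of §9.7-recipe chains OUTSIDE `𝒞_Diff` (kit j263239 / j263697,
HOME/L/res-L1-s13-pv-1/CENSUS-W13-RFLAT.md; kernel failure locus p481686 `Campaign.W13.N_not_rFlatTailPow`: the ∀-over-all-
chains form of rung 1 is FALSE, the `q`-th-power-free form has no counterexample in 12 255 heads and stays OPEN). Helper filed
`--supports stmt-ResolutionOfSingularities-15522` (no s13 statement item exists yet — res-L1-s13-plan-1 unseated); PROOFS ONLY.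

HONEST FRAMING. Nothing here is a statement of H. Hironaka's manuscript [Hironaka2017]; `𝒞_Diff` is OUR class; `℘(Ě,1)` is
the BOUND algebraic piece `Campaign.pAlgPiece K J b 1` (row 003 U17_2; U17_4 not used). RESCUE-SEED's caveat stands: any
R-flat finding leaves L-G4 / (127) open (barrier of record `KangarooShadeIncrease.Hauser2003_kangarooShadeIncrease`). AI
computation is weaker than expert review; nothing here is progress on resolution of singularities in positive characteristic.

CONTENTS (all `[folklore]`, sorry-free): `CampaignW13RFlatTailPowDiffKnockOut_holds` (the closed Prop, all parameters);
`A_mem_classDiff`, `R2_mem_classDiff`, `E2_mem_classDiff` (the recorded chains are in `𝒞_Diff`); `A_rFlatTailPow'`,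
`E2_rFlatTailPow'` (the instance results re-obtained THROUGH the closed Prop, as a usage check).
-/

noncomputable section

set_option linter.dupNamespace false -- mandated namespace of this single-conjunct summit

namespace Summit.ResolutionOfSingularities.ResolutionOfSingularities.Theorems.Campaign

open MvPolynomial
open Literature.AlgebraicGeometry.Resolution
open Literature.AlgebraicGeometry.Hironaka2017
open Literature.AlgebraicGeometry.Hironaka2017.S09LLUED (LLChainData)

universe u

/-- **Rung 1 closed on `𝒞_Diff`**: the v5 campaign Prop holds for every prime `p`, every `K`-algebra `O`, every ideal
`J` and every `b` — because `J ⊆ Diff^{(j)}(J)` and `Diff^{(j)}(J) ⊆ ℘(Ě,1)` for `j < b` (bridge of p475548), so a tail whose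
knock-out lies in `Diff^{(j)}(J)` has its `p^e`-th power in `℘(Ě,1)`; at `b = 0` the class is empty. [folklore] -/
theorem CampaignW13RFlatTailPowDiffKnockOut_holds (p : ℕ) (K : Type u) [CommRing K] {O : Type u} [CommRing O]
    [Algebra K O] (J : Ideal O) (b : ℕ) : CampaignW13RFlatTailPowDiffKnockOut p K J b := by
  rw [campaignW13RFlatTailPowDiffKnockOut_iff]
  rintro d ⟨hg, j, hj, hk⟩
  exact W13.pow_mem_pAlgPiece_one_of_sub_mem_diffIdeal K J (by omega) hj hg hk

/-! ## The recorded chains lie in `𝒞_Diff` -/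

/-- Example A (`g = y² + x⁵`, `p = 2`, `b = 2`): any chain datum headed by `g` with `e = 1` and tail `y` is in `𝒞_Diff` —
its knock-out `g − y² = x⁵ = x·∂ₓg ∈ Diff^{(1)}((g))`. [folklore] -/
theorem A_mem_classDiff (d : LLChainData (MvPolynomial (Fin 2) (ZMod 2)))
    (hdg : d.g 0 = X 1 ^ 2 + X 0 ^ 5) (hde : d.e = 1) (hdt : d.tail = X 1) :
    d.g 0 ∈ Ideal.span {(X 1 ^ 2 + X 0 ^ 5 : MvPolynomial (Fin 2) (ZMod 2))} ∧
      ∃ j < 2, d.g 0 - d.tail ^ (2 ^ d.e) ∈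
        diffIdeal (ZMod 2) j (Ideal.span {(X 1 ^ 2 + X 0 ^ 5 : MvPolynomial (Fin 2) (ZMod 2))}) := by
  refine ⟨hdg ▸ Ideal.subset_span rfl, 1, by norm_num, ?_⟩
  rw [hdg, hde, hdt]
  have h : (X 1 ^ 2 + X 0 ^ 5 : MvPolynomial (Fin 2) (ZMod 2)) - X 1 ^ 2 ^ 1 =
      X 0 * pderiv 0 (X 1 ^ 2 + X 0 ^ 5 : MvPolynomial (Fin 2) (ZMod 2)) := by
    rw [W13.A_pderiv]; ring
  rw [h]
  exact W13.mul_pderiv_mem_diffIdeal (ZMod 2) 0 _ _ le_rfl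

/-- The `p = 3` specimen R2 (`g = y³ + x₁²x₂⁹ + x₁²x₃⁶ + x₂⁹x₃`, `b = 3`): chain data with `e = 1`, tail `y` are in `𝒞_Diff` —
knock-out `= 2x₁·∂₁g + x₃·∂₃g ∈ Diff^{(1)}((g))`. [folklore] -/
theorem R2_mem_classDiff (d : LLChainData (MvPolynomial (Fin 4) (ZMod 3)))
    (hdg : d.g 0 = X 3 ^ 3 + X 0 ^ 2 * X 1 ^ 9 + X 0 ^ 2 * X 2 ^ 6 + X 1 ^ 9 * X 2) (hde : d.e = 1)
    (hdt : d.tail = X 3) :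
    d.g 0 ∈ Ideal.span {(X 3 ^ 3 + X 0 ^ 2 * X 1 ^ 9 + X 0 ^ 2 * X 2 ^ 6 + X 1 ^ 9 * X 2 :
        MvPolynomial (Fin 4) (ZMod 3))} ∧
      ∃ j < 3, d.g 0 - d.tail ^ (3 ^ d.e) ∈ diffIdeal (ZMod 3) j
        (Ideal.span {(X 3 ^ 3 + X 0 ^ 2 * X 1 ^ 9 + X 0 ^ 2 * X 2 ^ 6 + X 1 ^ 9 * X 2 :
          MvPolynomial (Fin 4) (ZMod 3))}) := by
  refine ⟨hdg ▸ Ideal.subset_span rfl, 1, by norm_num, ?_⟩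
  rw [hdg, hde, hdt]
  have h3 : (3 : MvPolynomial (Fin 4) (ZMod 3)) = 0 := by
    exact_mod_cast (CharP.cast_eq_zero (MvPolynomial (Fin 4) (ZMod 3)) 3)
  have h : (X 3 ^ 3 + X 0 ^ 2 * X 1 ^ 9 + X 0 ^ 2 * X 2 ^ 6 + X 1 ^ 9 * X 2 : MvPolynomial (Fin 4) (ZMod 3))
        - X 3 ^ 3 ^ 1 =
      2 * X 0 * pderiv 0 (X 3 ^ 3 + X 0 ^ 2 * X 1 ^ 9 + X 0 ^ 2 * X 2 ^ 6 + X 1 ^ 9 * X 2 :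
          MvPolynomial (Fin 4) (ZMod 3))
        + X 2 * pderiv 2 (X 3 ^ 3 + X 0 ^ 2 * X 1 ^ 9 + X 0 ^ 2 * X 2 ^ 6 + X 1 ^ 9 * X 2 :
          MvPolynomial (Fin 4) (ZMod 3)) := by
    rw [W13.R2_pderiv₁, W13.R2_pderiv₃]
    linear_combination (-(X 0 ^ 2 * X 1 ^ 9 + X 0 ^ 2 * X 2 ^ 6) : MvPolynomial (Fin 4) (ZMod 3)) * h3
  rw [h]
  exact Ideal.add_mem _ (W13.mul_pderiv_mem_diffIdeal (ZMod 3) 0 (2 * X 0) _ le_rfl)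
    (W13.mul_pderiv_mem_diffIdeal (ZMod 3) 2 (X 2) _ le_rfl)

/-- The `e = 2` head E2 (`g = y⁴ + x₁⁵ + x₁²x₂⁶`, `p = 2`, `b = 4`): chain data with `e = 2`, tail `y` are in `𝒞_Diff` —
the total knock-out `h(0) + h(1)² = x₁⁵ + x₁²x₂⁶ = x₁·∂₁g + x₁²·∂₁^{(2)}g ∈ Diff^{(2)}((g))`, `2 < 4`. [folklore] -/
theorem E2_mem_classDiff (d : LLChainData (MvPolynomial (Fin 3) (ZMod 2)))
    (hdg : d.g 0 = X 2 ^ 4 + X 0 ^ 5 + X 0 ^ 2 * X 1 ^ 6) (hde : d.e = 2) (hdt : d.tail = X 2) :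
    d.g 0 ∈ Ideal.span {(X 2 ^ 4 + X 0 ^ 5 + X 0 ^ 2 * X 1 ^ 6 : MvPolynomial (Fin 3) (ZMod 2))} ∧
      ∃ j < 4, d.g 0 - d.tail ^ (2 ^ d.e) ∈
        diffIdeal (ZMod 2) j (Ideal.span {(X 2 ^ 4 + X 0 ^ 5 + X 0 ^ 2 * X 1 ^ 6 : MvPolynomial (Fin 3) (ZMod 2))}) := by
  refine ⟨hdg ▸ Ideal.subset_span rfl, 2, by norm_num, ?_⟩
  rw [hdg, hde, hdt]
  have h : (X 2 ^ 4 + X 0 ^ 5 + X 0 ^ 2 * X 1 ^ 6 : MvPolynomial (Fin 3) (ZMod 2)) - X 2 ^ 2 ^ 2 =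
      -(X 0 * pderiv 0 (X 2 ^ 4 + X 0 ^ 5 + X 0 ^ 2 * X 1 ^ 6 : MvPolynomial (Fin 3) (ZMod 2))
        + X 0 ^ 2 * hasseDeriv (ZMod 2) (Finsupp.single 0 2)
            (X 2 ^ 4 + X 0 ^ 5 + X 0 ^ 2 * X 1 ^ 6 : MvPolynomial (Fin 3) (ZMod 2))) := by
    have e := W13.E2_tail_pow4
    linear_combination (-1 : MvPolynomial (Fin 3) (ZMod 2)) * e
  rw [h]
  exact neg_mem (Ideal.add_mem _ (W13.mul_pderiv_mem_diffIdeal (ZMod 2) 0 (X 0) _ (by norm_num))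
    (W13.mul_hasseDeriv_mem_diffIdeal (ZMod 2) (by rw [Finsupp.degree_single]) _ _))

/-! ## The instance results re-obtained through the closed Prop (usage check) -/

/-- Example A's tail survives R-flat — via the closed Prop and `A_mem_classDiff` (same statement as p478130's
`Campaign.W13.A_rFlatTailPow`, now routed through `CampaignW13RFlatTailPowDiffKnockOut`). [folklore] -/
theorem A_rFlatTailPow' (d : LLChainData (MvPolynomial (Fin 2) (ZMod 2)))
    (hdg : d.g 0 = X 1 ^ 2 + X 0 ^ 5) (hde : d.e = 1) (hdt : d.tail = X 1) :
    RFlatTailPow 2 (ZMod 2) (Ideal.span {(X 1 ^ 2 + X 0 ^ 5 : MvPolynomial (Fin 2) (ZMod 2))}) 2 d :=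
  (campaignW13RFlatTailPowDiffKnockOut_iff 2 (ZMod 2) _ 2).mp
    (CampaignW13RFlatTailPowDiffKnockOut_holds 2 (ZMod 2) _ 2) d (A_mem_classDiff d hdg hde hdt)

/-- The `e = 2` head's tail survives R-flat — via the closed Prop and `E2_mem_classDiff`. [folklore] -/
theorem E2_rFlatTailPow' (d : LLChainData (MvPolynomial (Fin 3) (ZMod 2)))
    (hdg : d.g 0 = X 2 ^ 4 + X 0 ^ 5 + X 0 ^ 2 * X 1 ^ 6) (hde : d.e = 2) (hdt : d.tail = X 2) :
    RFlatTailPow 2 (ZMod 2)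
      (Ideal.span {(X 2 ^ 4 + X 0 ^ 5 + X 0 ^ 2 * X 1 ^ 6 : MvPolynomial (Fin 3) (ZMod 2))}) 4 d :=
  (campaignW13RFlatTailPowDiffKnockOut_iff 2 (ZMod 2) _ 4).mp
    (CampaignW13RFlatTailPowDiffKnockOut_holds 2 (ZMod 2) _ 4) d (E2_mem_classDiff d hdg hde hdt)

end Summit.ResolutionOfSingularities.ResolutionOfSingularities.Theorems.Campaign

end
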